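import Summits.BirchSwinnertonDyer.BirchSwinnertonDyer.Theses.DerivedKatoValuationDoor
import Summits.BirchSwinnertonDyer.BirchSwinnertonDyer.Theorems.DerivedKatoValuationDoorFineLengthLeOneOfAnalyticRankTwoStubIntegralH1RankLeTwoOfDictionary
import Summits.BirchSwinnertonDyer.BirchSwinnertonDyer.Theorems.DerivedKatoValuationDoorIntegralH1RankLeTwoOfAnalyticRankTwoCrisAtOfPoint
import Summits.BirchSwinnertonDyer.BirchSwinnertonDyer.Theorems.KatoDescentPotSupersingularIntegralH1RankZero
import HarnessLib

set_option linter.dupNamespace false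
set_option autoImplicit false

/-!
# Support `IntegralH1RankCapGivesStrictCap` (stmt-BirchSwinnertonDyer-23753, route `DerivedKatoValuationDoor`, (β) gen 2):
# BY NAME from [KP07, Lemma 1.4], and UNCONDITIONALLY off the phantom cell
# (INPUTS desk, τ7 follow-up; seat `bsd-inputs-honda-p1` g14; helper `--supports 23753`, closes nothing)

The (β) re-split of route `DerivedKatoValuationDoor` (rev 10) made S2 the deciding crux
(`IntegralH1RankLeTwoOfAnalyticRankTwo`, stmt-BirchSwinnertonDyer-23752) and introduced the glue support
`IntegralH1RankCapGivesStrictCap` (stmt-BirchSwinnertonDyer-23753): at a door prime,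
`rank_{ℤ_p} H¹(ℤ[1/p], T_pW) ≤ 2 ⇒` any two STRICT integral classes are `ℤ_p`-dependent — «PRINT (Poitou–Tate: the
image of `loc_p` on `H¹(ℤ[1/p], V_pE)` is ONE line), INPUTS row G100».  This file serves it from what the INPUTS
desk landed today:

* §1 **`integralH1RankCapGivesStrictCap_of_lemma14 (hKP) : IntegralH1RankCapGivesStrictCap`** — the item's signature
  VERBATIM from the named fact `KuriharaPollack2007.lemma14_locP_image_rankOne` alone (its `≥ 1` half: one integral
  class of non-torsion localisation), via the unconditional linear algebra
  `strictPairDependent_of_rank_le_two_of_nonTorsionLoc` (file `…StubIntegralH1RankLeTwoOfDictionary`, §3).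
  CONDITIONAL on the named fact (helper; not a closer).
* §2 **UNCONDITIONAL off the phantom cell.**  The conclusion of the item holds at EVERY prime `p` (no door
  hypothesis needed) as soon as EITHER `W(ℚ)` has a point of infinite order — its integral `T_p`-adic Kummer class has
  non-zero logarithm (LEAD dkd-p1 g3, `exists_integral_hasLocPKummerLog_ne_zero_of_not_isOfFinAddOrder`), hence
  non-torsion localisation (`nonTorsionLoc_of_hasLocPKummerLog_ne_zero`, §5 of the sibling file) — OR `W(ℚ)` and
  `Ш(W)[p^∞]` are both finite — then `rank_{ℤ_p} H¹(ℤ[1/p], T_pW) ≤ 1` outright (cell bsd-potss, (R0)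
  `IntegralH1RankZero.exists_smul_add_smul_eq_zero_of_mem_integralH1`, used by name) and ANY two integral classes
  are dependent.
  So the only `(W, p)` where 23753 is not yet a kernel theorem is the cell «`W(ℚ)` finite ∧ `Ш(W)[p^∞]` infinite»
  (there the non-torsion localisation is Kato's zeta class / Tate's global Euler characteristic — print, not tree).

HONEST FRAMING: §1 conditional on a named fact, §2 unconditional; no item closed; BSD is NOT proved by any of this.
References: [KP07] = [cite: KuriharaPollack2007, §1.4 Lemma 1.4]; [PR93] = [cite: PerrinRiou1993AIF, Lemme 2.3.9];
[Kato04] = [cite: Kato2004Asterisque, Thm. 14.5 (1), §14.1]; [BKS19] = [cite: BurnsKuriharaSano2019, Prop. 4.5].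
-/

noncomputable section

open scoped Classical

namespace Summit.BirchSwinnertonDyer.BirchSwinnertonDyer.Theorems.DerivedKatoValuationDoor

open Field
open Literature Literature.NumberTheory.GaloisRepresentations
open Literature.NumberTheory.EllipticCurves Literature.NumberTheory.EllipticCurves.Kato2004
open Literature.NumberTheory.EllipticCurves.Kato2004.EulerSystemValues
open Summit.BirchSwinnertonDyer.BirchSwinnertonDyer.Theses.DerivedKatoValuationDoor (IntegralH1RankCapGivesStrictCap)

/-! ## §1 The item by name from [KP07, Lemma 1.4] -/

/-- **`IntegralH1RankCapGivesStrictCap` (stmt-BirchSwinnertonDyer-23753) VERBATIM from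
`KuriharaPollack2007.lemma14_locP_image_rankOne`.**  At a door prime (`5 ≤ p` ⇒ `p ≠ 2`; `IsOrdinaryAt` ⇒ good
reduction, `isOrdinaryAt_iff`) the fact's `≥ 1` half supplies an integral class with non-torsion localisation, and
`strictPairDependent_of_rank_le_two_of_nonTorsionLoc` turns `rank ≤ 2` into strict pair dependence.  CONDITIONAL on
the named fact (helper).  [cite: KuriharaPollack2007, §1.4 Lemma 1.4] [cite: BurnsKuriharaSano2019, Prop. 4.5 (proof)] -/
theorem integralH1RankCapGivesStrictCap_of_lemma14
    (hKP : KuriharaPollack2007.lemma14_locP_image_rankOne) : IntegralH1RankCapGivesStrictCap := by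
  intro W _ _ p _ _ hdoor hrank x y hx hy hxs hys
  have hp2 : p ≠ 2 := by
    have h5 := hdoor.1
    omega
  have hgood : W.HasGoodReductionAtPrime p := ((isOrdinaryAt_iff W p).1 hdoor.2.1).1
  exact strictPairDependent_of_rank_le_two_of_lemma14 W p hKP hp2 hgood hrank x y hx hy hxs hys

/-! ## §2 Unconditionally, off the phantom cell -/

section OffPhantom

variable (W : WeierstrassCurve ℚ) [W.IsElliptic] [W.IsGloballyMinimal] (p : ℕ) [Fact p.Prime]
  [ContinuousSMul ℤ_[p] (W.tateModule p)]

/-- **With a rational point of infinite order, `rank ≤ 2 ⇒` strict pair dependence, at EVERY prime** (no door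
hypothesis, no named fact): the point's integral Kummer class has non-zero logarithm
(`exists_integral_hasLocPKummerLog_ne_zero_of_not_isOfFinAddOrder`), hence non-torsion localisation, and
`strictPairDependent_of_rank_le_two_of_hasLocPKummerLog_ne_zero` applies.
[cite: KuriharaPollack2007, §1.4 Lemma 1.4] [cite: BlochKato1990, Ex. 3.11] -/
theorem strictPairDependent_of_rank_le_two_of_not_isOfFinAddOrder {P : W.toAffine.Point}
    (hP : ¬ IsOfFinAddOrder P)
    (hrank : Module.rank ℤ_[p] ↥(integralH1 (tateRep W p) p ⊤) ≤ 2)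
    (x y : H1 (tateRep W p) ⊤) (hx : x ∈ integralH1 (tateRep W p) p ⊤)
    (hy : y ∈ integralH1 (tateRep W p) p ⊤) (hxs : ∀ k : ℕ, locModPk W p k x = 0)
    (hys : ∀ k : ℕ, locModPk W p k y = 0) :
    ∃ a b : ℤ_[p], (a ≠ 0 ∨ b ≠ 0) ∧ a • x + b • y = 0 := by
  obtain ⟨x₀, t, hx₀, ht, hlog⟩ := exists_integral_hasLocPKummerLog_ne_zero_of_not_isOfFinAddOrder W p hP
  exact strictPairDependent_of_rank_le_two_of_hasLocPKummerLog_ne_zero W p hrank hx₀ hlog ht x y hx hy hxs hys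

/-- **With `rank E(ℚ) ≠ 0`, `rank ≤ 2 ⇒` strict pair dependence, at every prime** (a curve of positive rank has a
point of infinite order, `exists_not_isOfFinAddOrder_of_mordellWeilRank_ne_zero`). Unconditional.
[cite: KuriharaPollack2007, §1.4 Lemma 1.4] [cite: SilvermanAEC2009, VIII.6.7] -/
theorem strictPairDependent_of_rank_le_two_of_mordellWeilRank_ne_zero (hr : W.mordellWeilRank ≠ 0)
    (hrank : Module.rank ℤ_[p] ↥(integralH1 (tateRep W p) p ⊤) ≤ 2)
    (x y : H1 (tateRep W p) ⊤) (hx : x ∈ integralH1 (tateRep W p) p ⊤)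
    (hy : y ∈ integralH1 (tateRep W p) p ⊤) (hxs : ∀ k : ℕ, locModPk W p k x = 0)
    (hys : ∀ k : ℕ, locModPk W p k y = 0) :
    ∃ a b : ℤ_[p], (a ≠ 0 ∨ b ≠ 0) ∧ a • x + b • y = 0 := by
  obtain ⟨P, hP⟩ := W.exists_not_isOfFinAddOrder_of_mordellWeilRank_ne_zero hr
  exact strictPairDependent_of_rank_le_two_of_not_isOfFinAddOrder W p hP hrank x y hx hy hxs hys

/-- **23753's implication at `(W, p)` OFF THE PHANTOM CELL, unconditionally**: if either `W(ℚ)` has a point of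
infinite order or `W(ℚ)` and `Ш(W)[p^∞]` are both finite, then `rank ≤ 2 ⇒` strict pair dependence (any prime
`p`).  The remaining cell «`W(ℚ)` finite ∧ `Ш(W)[p^∞]` infinite» is where the class of non-torsion localisation is
Kato's zeta element / Tate's global Euler characteristic (print; the named fact `KuriharaPollack2007.lemma14_…`, §1).
[cite: KuriharaPollack2007, §1.4 Lemma 1.4] [cite: Kato2004Asterisque, Thm. 14.5 (1) (p. 236)] -/
theorem strictPairDependent_of_rank_le_two_offPhantom
    (h : (∃ P : W.toAffine.Point, ¬ IsOfFinAddOrder P) ∨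
      (Finite W.toAffine.Point ∧ Finite (AddCommGroup.primaryComponent W.sha p)))
    (hrank : Module.rank ℤ_[p] ↥(integralH1 (tateRep W p) p ⊤) ≤ 2)
    (x y : H1 (tateRep W p) ⊤) (hx : x ∈ integralH1 (tateRep W p) p ⊤)
    (hy : y ∈ integralH1 (tateRep W p) p ⊤) (hxs : ∀ k : ℕ, locModPk W p k x = 0)
    (hys : ∀ k : ℕ, locModPk W p k y = 0) :
    ∃ a b : ℤ_[p], (a ≠ 0 ∨ b ≠ 0) ∧ a • x + b • y = 0 := by
  rcases h with ⟨P, hP⟩ | ⟨hfin, hsha⟩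
  · exact strictPairDependent_of_rank_le_two_of_not_isOfFinAddOrder W p hP hrank x y hx hy hxs hys
  · haveI := hfin
    haveI := hsha
    -- (R0): with `W(ℚ)` and `Ш(W)[p^∞]` finite ANY two integral classes are dependent (rank ≤ 1)
    exact IntegralH1RankZero.exists_smul_add_smul_eq_zero_of_mem_integralH1 W p x y hx hy

end OffPhantom

end Summit.BirchSwinnertonDyer.BirchSwinnertonDyer.Theorems.DerivedKatoValuationDoor

end
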